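import Summits.QuantumFields.GaugeBoot.PeriodicWords
import Summits.QuantumFields.YangMills.Theorems.ScalingWindowSplitCurvatureAmnesiaWilsonSchwingerDyson
import HarnessLib

/-!
# The flow derivative of a word holonomy along the one-link shift, periodic lattice (gauge-boot, periodic loop equations 2/5)

HONEST FRAMING (cell `pub-gaugeboot`, page 1 of every file): the venture produces certified bounds
on lattice expectations at stated coupling, gauge group, dimension and torus size; NOT a mass gap,
NOT a continuum limit, NOT a string tension; NOT Yang–Mills-summit-bearing (barriers
`FixedCouplingUltralocality`, `PerturbativeInvisibility`).

File 2/5 of the re-typing of the tree's loop-equation stack over the periodic lattice `(A, e)` of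
`TiltedLatticeGauge.lean` (see `PeriodicWords.lean`); this is the verbatim analogue of
`WordDerivative.lean`. For a matrix representation `ρ : G →* M_N(ℂ)`, a link `l`, a matrix `X` and a
multiplicative family `k : ℝ → G` with `ρ(k t) = exp(tX)`:

* the one-link LEFT SHIFT `U ↦ U[l ↦ k(t) U_l]` on `ι → G` (any index type; `G : Type` as in the
  torus files): flow property, value at
  `0`, continuity, and the one-factor derivatives `hasDerivAt_update_factor(_inv)` (re-typed from the
  torus file `…WilsonSchwingerDyson.lean`, whose statements are over `Edge d L`);
* `stepIns`, `insDeriv` — the INSERTION DERIVATIVE of `ρ(hol_w)` (Leibniz rule, recursion on the word);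
  `hasDerivAt_wordHolonomy` proves it is the derivative at `t = 0`, `continuous_insDeriv` its
  continuity in `U`;
* `occTerm`, `trace_mul_insDeriv` — the OCCURRENCE EXPANSION `tr(Y·insDeriv) = Σ_k occTerm_k`: `X` is
  inserted after the prefix at every forward traversal of `l` by the `k`-th letter and `−X` before
  the suffix at every backward traversal.

Everything is `[folklore]` matrix calculus; no measure theory here.

References: M. Creutz, *Quarks, gluons and lattices* (1983) Ch. 11; S. Chatterjee, arXiv:1502.07719
§3; S. Cao, M. Park, S. Sheffield, Comm. AMS 5 (2025),
Thm. 5.7 (`U(N)`) / Thm. 6.104 (`SU(N)`) (arXiv:2307.06790 numbering; informally Thm. 1.14).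
-/

noncomputable section

open MeasureTheory Filter Topology NormedSpace
open scoped Matrix.Norms.Frobenius Matrix
open Summit.QuantumFields.YangMills.Cruxes.CurvatureAmnesia.WardDefect.SchwingerDyson
  (oneParam_zero oneParam_neg hasDerivAt_exp_coe_smul)

namespace Summit.QuantumFields.GaugeBoot

namespace TiltedRP

/-! ### The one-link left shift on `ι → G` -/

section Shift

variable {ι : Type*} [DecidableEq ι] {N : ℕ} {G : Type} [Group G] {k : ℝ → G}

/-- The one-link left shift `U ↦ U[l ↦ k(t)U_l]` is a flow: `T_{t+s} = T_t ∘ T_s`. [folklore] -/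
theorem update_shift_flow (hk : ∀ s t, k (s + t) = k s * k t) (l : ι) (s t : ℝ) (U : ι → G) :
    Function.update U l (k (t + s) * U l) =
      Function.update (Function.update U l (k s * U l)) l
        (k t * Function.update U l (k s * U l) l) := by
  rw [Function.update_idem, Function.update_self, ← mul_assoc, hk]

/-- `T_0 = id`. [folklore] -/
theorem update_shift_zero (hk : ∀ s t, k (s + t) = k s * k t) (l : ι) (U : ι → G) :
    Function.update U l (k 0 * U l) = U := by
  rw [oneParam_zero hk, one_mul, Function.update_eq_self]

/-- The shift is continuous in the configuration. [folklore] -/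
theorem continuous_update_shift [TopologicalSpace G] [IsTopologicalGroup G] (l : ι) (g : G) :
    Continuous fun U : ι → G => Function.update U l (g * U l) :=
  continuous_id.update l (continuous_const.mul (continuous_apply l))

variable (ρ : G →* Matrix (Fin N) (Fin N) ℂ) {X : Matrix (Fin N) (Fin N) ℂ}

/-- A direct factor `ρ(U[l ↦ k(t)U_l]_{l'})`: derivative `X ρ(U_l)` if `l' = l`, else `0`. [folklore] -/
theorem hasDerivAt_update_factor (hX : ∀ t, ρ (k t) = exp ((t : ℂ) • X)) (l l' : ι) (U : ι → G) :
    HasDerivAt (fun t : ℝ => ρ (Function.update U l (k t * U l) l'))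
      (if l' = l then X * ρ (U l) else 0) 0 := by
  by_cases h : l' = l
  · subst h
    simp only [Function.update_self, if_true, map_mul, hX]
    exact (hasDerivAt_exp_coe_smul X).mul_const _
  · simp only [Function.update_of_ne h, h, if_false]
    exact hasDerivAt_const _ _

/-- An inverse factor `ρ((U[l ↦ k(t)U_l]_{l'})⁻¹)`: derivative `ρ(U_l⁻¹)(−X)` if `l' = l`, else `0`.
[folklore] -/
theorem hasDerivAt_update_factor_inv (hk : ∀ s t, k (s + t) = k s * k t)
    (hX : ∀ t, ρ (k t) = exp ((t : ℂ) • X)) (l l' : ι) (U : ι → G) :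
    HasDerivAt (fun t : ℝ => ρ ((Function.update U l (k t * U l) l')⁻¹))
      (if l' = l then ρ ((U l)⁻¹) * (-X) else 0) 0 := by
  by_cases h : l' = l
  · subst h
    have hfun : (fun t : ℝ => ρ ((Function.update U l' (k t * U l') l')⁻¹)) =
        fun t : ℝ => ρ ((U l')⁻¹) * exp ((t : ℂ) • (-X)) := by
      funext t
      rw [Function.update_self, mul_inv_rev, ← oneParam_neg hk, map_mul, hX]
      congr 2
      push_cast
      rw [neg_smul, smul_neg]
    rw [hfun]
    simp only [if_true]
    exact (hasDerivAt_exp_coe_smul (-X)).const_mul _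
  · simp only [Function.update_of_ne h, h, if_false]
    exact hasDerivAt_const _ _

end Shift

/-! ### The insertion derivative of a word holonomy -/

section Insertion

variable {A : Type*} [AddCommGroup A] [DecidableEq A] {d N : ℕ} {G : Type} [Group G]
  (ρ : G →* Matrix (Fin N) (Fin N) ℂ) (e : Fin d → A) (l : Link A d) (X : Matrix (Fin N) (Fin N) ℂ)

/-- The flow derivative of ONE step factor `ρ(step holonomy)` along the left shift at `l` with
`ρ(k(t)) = exp(tX)`: `X·ρ(U_l)` at a forward traversal of `l`, `ρ(U_l⁻¹)·(−X)` at a backward one, `0`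
if the step does not traverse `l`. [folklore] -/
def stepIns (U : Config A d G) (x : A) (s : Step d) : Matrix (Fin N) (Fin N) ℂ :=
  if s.link e x = l then (if s.isFwd then X * ρ (U l) else ρ ((U l)⁻¹) * (-X)) else 0

/-- The INSERTION DERIVATIVE of the word holonomy `ρ(hol_w)` along the one-link shift at `l` in
direction `X`: the Leibniz sum over the letters of `w`. [folklore] -/
def insDeriv (U : Config A d G) : A → Word d → Matrix (Fin N) (Fin N) ℂ
  | _, [] => 0
  | x, s :: w => stepIns ρ e l X U x s * ρ (wordHolonomy e U (s.move e x) w) +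
      ρ (stepHolonomy e U x s) * insDeriv U (s.move e x) w

/-- Unfolding lemma `insDeriv_nil`. [folklore] -/
@[simp] theorem insDeriv_nil (U : Config A d G) (x : A) : insDeriv ρ e l X U x [] = 0 := rfl

/-- Unfolding lemma `insDeriv_cons`. [folklore] -/
theorem insDeriv_cons (U : Config A d G) (x : A) (s : Step d) (w : Word d) :
    insDeriv ρ e l X U x (s :: w) = stepIns ρ e l X U x s * ρ (wordHolonomy e U (s.move e x) w) +
      ρ (stepHolonomy e U x s) * insDeriv ρ e l X U (s.move e x) w := rfl

variable {ρ X} {k : ℝ → G}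

/-- One step factor is differentiable along the shift, with derivative `stepIns`. [folklore] -/
theorem hasDerivAt_stepHolonomy (hk : ∀ s t, k (s + t) = k s * k t)
    (hX : ∀ t, ρ (k t) = exp ((t : ℂ) • X)) (U : Config A d G) (x : A) (s : Step d) :
    HasDerivAt (fun t : ℝ => ρ (stepHolonomy e (Function.update U l (k t * U l)) x s))
      (stepIns ρ e l X U x s) 0 := by
  cases s with
  | fwd μ =>
    simpa [stepIns] using hasDerivAt_update_factor ρ hX l (x, μ) U
  | bwd μ =>
    simpa [stepIns] using hasDerivAt_update_factor_inv ρ hk hX l (x - e μ, μ) U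

/-- **Leibniz rule for word holonomies**: along the one-link shift the matrix `ρ(hol_w(U))` is
differentiable at `t = 0` with derivative `insDeriv`. [folklore] -/
theorem hasDerivAt_wordHolonomy (hk : ∀ s t, k (s + t) = k s * k t)
    (hX : ∀ t, ρ (k t) = exp ((t : ℂ) • X)) (U : Config A d G) : ∀ (x : A) (w : Word d),
    HasDerivAt (fun t : ℝ => ρ (wordHolonomy e (Function.update U l (k t * U l)) x w))
      (insDeriv ρ e l X U x w) 0
  | x, [] => by
    simp only [wordHolonomy_nil, map_one, insDeriv_nil]
    exact hasDerivAt_const _ _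
  | x, s :: w => by
    have h1 := hasDerivAt_stepHolonomy e l hk hX U x s
    have h2 := hasDerivAt_wordHolonomy hk hX U (s.move e x) w
    have h := h1.mul h2
    have hz : Function.update U l (k 0 * U l) = U := update_shift_zero hk l U
    simp only [hz] at h
    refine (h.congr_of_eventuallyEq (Eventually.of_forall fun t => ?_)).congr_deriv ?_
    · simp only [Pi.mul_apply, wordHolonomy_cons, map_mul]
    · rw [insDeriv_cons]

section Continuity

variable [TopologicalSpace G] [IsTopologicalGroup G]

/-- `U ↦ stepIns` is continuous (for continuous `ρ`). [folklore] -/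
theorem continuous_stepIns (hρ : Continuous ρ) (x : A) (s : Step d) :
    Continuous fun U : Config A d G => stepIns ρ e l X U x s := by
  unfold stepIns
  split_ifs
  · exact continuous_const.mul (hρ.comp (continuous_apply l))
  · exact (hρ.comp ((continuous_apply l).inv)).mul continuous_const
  · exact continuous_const

/-- `U ↦ insDeriv` is continuous (for continuous `ρ`). [folklore] -/
theorem continuous_insDeriv (hρ : Continuous ρ) : ∀ (x : A) (w : Word d),
    Continuous fun U : Config A d G => insDeriv ρ e l X U x w
  | x, [] => by simpa using continuous_const
  | x, s :: w => by
    simp only [insDeriv_cons]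
    exact ((continuous_stepIns e l hρ x s).mul
      (hρ.comp (continuous_wordHolonomy e (s.move e x) w))).add
      ((hρ.comp (continuous_stepHolonomy e x s)).mul (continuous_insDeriv hρ (s.move e x) w))

end Continuity

/-! ### The occurrence expansion of `tr(Y · insDeriv)` -/

variable (ρ X)

/-- The `k`-th OCCURRENCE TERM of `tr(Y·insDeriv_X hol_w)`: if the `k`-th letter of `w` traverses `l`
forward, `tr(Y·ρ(hol w[0,k))·X·ρ(hol w[k,n)))`; if backward, `−tr(Y·ρ(hol w[0,k])·X·ρ(hol w(k,n)))`;
else `0`. [folklore] -/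
def occTerm (Y : Matrix (Fin N) (Fin N) ℂ) (U : Config A d G) (x : A) (w : Word d) (k : ℕ) : ℂ :=
  match w[k]? with
  | none => 0
  | some s =>
    if s.link e (Word.siteAt e x w k) = l then
      (if s.isFwd then
        (Y * ρ (wordHolonomy e U x (w.take k)) * X *
          ρ (wordHolonomy e U (Word.siteAt e x w k) (w.drop k))).trace
      else
        -(Y * ρ (wordHolonomy e U x (w.take (k + 1))) * X *
          ρ (wordHolonomy e U (Word.siteAt e x w (k + 1)) (w.drop (k + 1)))).trace)
    else 0

variable {ρ X}

/-- Shifting the occurrence index past the first letter. [folklore] -/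
theorem occTerm_cons_succ (Y : Matrix (Fin N) (Fin N) ℂ) (U : Config A d G) (x : A) (s : Step d)
    (w : Word d) (k : ℕ) :
    occTerm ρ e l X Y U x (s :: w) (k + 1) =
      occTerm ρ e l X (Y * ρ (stepHolonomy e U x s)) U (s.move e x) w k := by
  unfold occTerm
  simp only [List.getElem?_cons_succ, Word.siteAt_succ_cons, List.take_succ_cons, List.drop_succ_cons,
    wordHolonomy_cons, map_mul, Matrix.mul_assoc]

/-- The occurrence term at the first letter. [folklore] -/
theorem occTerm_cons_zero (Y : Matrix (Fin N) (Fin N) ℂ) (U : Config A d G) (x : A) (s : Step d)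
    (w : Word d) :
    occTerm ρ e l X Y U x (s :: w) 0 =
      (Y * stepIns ρ e l X U x s * ρ (wordHolonomy e U (s.move e x) w)).trace := by
  unfold occTerm stepIns
  simp only [List.getElem?_cons_zero, Word.siteAt_zero, List.take_zero, wordHolonomy_nil, map_one,
    List.drop_zero, List.take_succ_cons, wordHolonomy_cons, mul_one, Word.siteAt_succ_cons,
    List.drop_succ_cons]
  by_cases he : s.link e x = l
  · simp only [he, if_true]
    cases s with
    | fwd μ =>
      simp only [Step.link_fwd] at he
      simp only [Step.isFwd_fwd, if_true, stepHolonomy_fwd, he, map_mul, Matrix.mul_assoc]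
    | bwd μ =>
      simp only [Step.link_bwd] at he
      simp only [Step.isFwd_bwd, Bool.false_eq_true, if_false, stepHolonomy_bwd, he, Matrix.mul_neg,
        Matrix.neg_mul, Matrix.trace_neg, Matrix.mul_assoc]
  · simp [he]

/-- **Occurrence expansion**: `tr(Y·insDeriv_X hol_w) = Σ_{k<|w|} occTerm_k`. [folklore] -/
theorem trace_mul_insDeriv (U : Config A d G) :
    ∀ (Y : Matrix (Fin N) (Fin N) ℂ) (x : A) (w : Word d),
      (Y * insDeriv ρ e l X U x w).trace = ∑ k ∈ Finset.range w.length, occTerm ρ e l X Y U x w k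
  | Y, x, [] => by simp
  | Y, x, s :: w => by
    rw [List.length_cons, Finset.sum_range_succ', occTerm_cons_zero, insDeriv_cons, Matrix.mul_add,
      Matrix.trace_add, ← Matrix.mul_assoc, ← Matrix.mul_assoc,
      trace_mul_insDeriv U (Y * ρ (stepHolonomy e U x s)) (s.move e x) w]
    simp only [occTerm_cons_succ]
    ring

end Insertion

end TiltedRP

end Summit.QuantumFields.GaugeBoot

end
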